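import Summits.HodgeConjecture.HodgeConjecture.Theorems.K2E1bModelOfRecordPrelims          -- ★ prelims (this seat): nonzero hw vector, `six_dvd_of_labels`, `exists_mk_eq_mk_ofRecord`
import Summits.HodgeConjecture.HodgeConjecture.Theorems.K2E1bU21HwLineMultiplicityOne      -- ★ αᵤ-2c: `hwLines_of_isCohUnitaryIrrep`
import Summits.HodgeConjecture.HodgeConjecture.Theorems.K2E1bU21DatumRelations             -- ★ αᵤ-4b: `exists_datum`
import Summits.HodgeConjecture.HodgeConjecture.Theorems.K2E1bU21ModelEquiv                 -- ★ αᵤ-5b §2: `exists_lieEquiv_of_datum`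
import Summits.HodgeConjecture.HodgeConjecture.Theorems.K2E1bUnitaryDualOfPartsCohUnitary  -- ★ Q13: `U8.ModelOfRecordCohUnitaryStmt`
import HarnessLib

/-!
# K2 ∕ E1b — αᵤ road HEAD «MODEL OF RECORD, COH-UNITARY»: `modelOfRecordCohUnitary : U8.ModelOfRecordCohUnitaryStmt`

Cell hodgecm-mathlib, Track B «K2-LIT», engine E1b, unit U8; crux item h413 = stmt-HodgeConjecture-24833 (supports-only helper; the file closes no item by
itself — it PAYS the 8b-αᵤ socket `sig_K2E1bModelOfRecordCohUnitary : ModelOfRecordCohUnitaryStmt` of the U8d line BY NAME once K2E1b-plan wires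
`:= modelOfRecordCohUnitary` in the next edition).  DEAL (D-αᵤ5) K2E1b-plan (g4) 2026-09-04T04:13:05Z (cut 04:27:44Z ∕ 04:42:54Z: 5b, 5b§2 → K2E4-p10 (g3);
head → desk K2-defs1 (g3)).  THEOREMS ONLY — no `def`, no `sorry`, no axiom, no instance declaration (one `attribute [local instance] LieRing.ofAssociativeRing`),
no notation.

## The statement (★ Q13 `K2E1bUnitaryDualOfPartsCohUnitary`, ns `…K2E1bGKCohomologyU21.U8`)

`ModelOfRecordCohUnitaryStmt : Prop := ∀ (r : GKIrrep G21) (κ e : ℤ), IsCohUnitaryIrrep r.ρK r.ρ𝔤 → HasChiScalars r.ρ𝔤 κ e →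
  ∃ (𝒟 : SU21Datum) (hGK : IsGKModule G21 (ρKOfRecord 𝒟 e) (σOfRecord 𝒟 e)) (hirr : IsIrreducibleGK (ρKOfRecord 𝒟 e) (σOfRecord 𝒟 e)),
    GKIrrClass.mk r = GKIrrClass.mk ⟨𝒟.V, ρKOfRecord 𝒟 e, σOfRecord 𝒟 e, hGK, hirr⟩`
— EVERY irreducible admissible `(𝔲(2,1), K)`-module unitary along `𝔭 ⊕ ℝz₀` with central character `e` is, up to `(𝔤, K)`-equivalence, the twisted
structure of record of a Kovačević datum [Kovacevic2021, §3 Thm. 1–3].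

## The assembly (the αᵤ road of K2E1b-plan (g4), MEMO `K2/K2E1b-plan/g4/MEMO-alpha_u-files-3-5…md`)

§1 `modelOfRecordCohUnitary_of_lieEquivOfDatum` — the head MODULO the `𝔤`-isomorphism of the datum, as one hypothesis `h5b` (kept for the record; it was
★-boxed GREEN before 5b§2 existed): for `r`, `κ`, `e`, `hr : IsCohUnitaryIrrep`, `hχ : HasChiScalars r.ρ𝔤 κ e`:
* every torus weight of `r` has central label `e` (`hχ.2` + ★ αᵤ-1b `labelE_eq_of_center`);
* ★ αᵤ-2c `hwLines_of_isCohUnitaryIrrep r hr` (highest-weight LINES — Kovačević's multiplicity-one assumption, proved via ★ 2b Gelfand's trick) feeds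
  ★ αᵤ-4b `exists_datum r.ρ𝔤 r.isGKModule e` ⇒ a datum `𝒟` and a normal-form family `u` with the five clauses (i)–(v);
* ★ prelims `exists_mem_hwSpace_ne_zero` + clause (iii) ⇒ some `u n m ≠ 0`; clauses (i)–(ii) + ★ `six_dvd_of_labels` ⇒ `𝒟` is integral at `e`;
* `h5b` ⇒ `Φ : 𝒟.V ≃ₗ[ℂ] r.V` intertwining `σOfRecord 𝒟 e` and `r.ρ𝔤`; ★ prelims `exists_mk_eq_mk_ofRecord` (★ `isGKModule_ofRecord`, ★
  `areGKEquivalent_of_lieEquiv` with `K = exp 𝔨` ★ `upq_exists_expK_eq`, ★ `isIrreducibleGK_of_gkEquiv`, ★ `GKIrrClass.mk_eq_mk_iff`) ⇒ the class.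
§2 **`modelOfRecordCohUnitary`** — `h5b` discharged by ★ αᵤ-5b§2 `exists_lieEquiv_of_datum r.ρ𝔤 r.isGKModule r.isIrreducible hi hS hstr hT hne` (K2E4-p10 (g3):
★ 5b `exists_intertwiner_of_datum` — the injective intertwiner on Kovačević's basis — then surjectivity through ★ αᵤ-5a′ `isGKSubmodule_of_lieStable` and
irreducibility).

αᵤ ROAD LEDGER (all ★, all `--supports stmt-HodgeConjecture-24833`): 1 p857218 · 1b p857265 · 2a p857192 · 2b p857241 · 2c p857364+p857386 · 3 p857269 ·
4a p857310 · 4b p857334 · 5a′ p857317 · 5b p857370+p857395 · 5b§2 p857416 · prelims p857399 · this head.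

Sources: [Kovacevic2021, §3 Def. 1, Thm. 1–3, Remark 1; §6]; [Kraljevic1973]; [KnappVogan1995, §I.4 (1.64)–(1.65), §II.4, §IV.1]; [BorelWallach2000, 0 §2.5];
[Rogawski1990, §12.3 pp. 176–177].

HONEST LABEL: HC_CM is proved only modulo the 7 printed citations (2 remaining named inputs: hLiu418 = stmt-HodgeConjecture-24832, h413 = stmt-HodgeConjecture-24833)
until rung 0 closes.  This file makes 8b-αᵤ payable BY NAME; the U8-1 cone still contains 8a `sig_K2E1bCDPseudoCoefficient` (XL, letter-grade), so
`sig_K2E1bArchPacketSigns` is NOT closed by it.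
-/

-- Mathlib idiom (as in ★ `GKModules` and every `(𝔤, K)` file of the tree): the commutator bracket on `Module.End ℂ V` ∕ matrices, needed to MENTION
-- `r.ρ𝔤 : G21.lie →ₗ⁅ℝ⁆ Module.End ℂ r.V` (`LieRing.ofAssociativeRing` is a `def` in Mathlib).
attribute [local instance 100] LieRing.ofAssociativeRing

set_option autoImplicit false
set_option linter.dupNamespace false

noncomputable section

open Module
open Literature.RepresentationTheory Literature.RepresentationTheory.BorelWallach2000
open Literature.RepresentationTheory.KonnoKonno2007 Literature.RepresentationTheory.KonnoKonno2007.RealDualPair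
open Literature.RepresentationTheory.Kovacevic2021
open Literature.NumberTheory.Automorphic
open Summit.HodgeConjecture.HodgeConjecture.Cruxes.H413.F0P3bLocalAPacketsDefs (G21)
open Summit.HodgeConjecture.HodgeConjecture.Cruxes.H413.F0P3bArchDegOnePackage (IsCohUnitaryIrrep)
open Summit.HodgeConjecture.HodgeConjecture.Cruxes.H413.K2E1bGKCohomologyU21
open Summit.HodgeConjecture.HodgeConjecture.Cruxes.H413.K2E1bU21Weights
open Summit.HodgeConjecture.HodgeConjecture.Cruxes.H413.K2E1bCarriersOfRecord
open Summit.HodgeConjecture.HodgeConjecture.Cruxes.H413.K2E1bU21DatumRelations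
open Summit.HodgeConjecture.HodgeConjecture.Cruxes.H413.K2E1bU21HwLines
open Summit.HodgeConjecture.HodgeConjecture.Cruxes.H413.K2E1bModelOfRecord
open Summit.HodgeConjecture.HodgeConjecture.Cruxes.H413.K2E1bU21ModelEquiv

namespace Summit.HodgeConjecture.HodgeConjecture.Cruxes.H413.K2E1bGKCohomologyU21.U8

/-! ## §1 The head modulo the `𝔤`-isomorphism of the datum -/

/-- **8b-αᵤ MODULO THE `𝔤`-ISOMORPHISM OF THE DATUM (5b)**: if every irreducible `(𝔤, K)`-module of `U(2,1)` carrying a Kovačević datum `(𝒟, u)` in the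
five-clause normal form of ★ `exists_datum` (with some `u n m ≠ 0`) is `𝔤`-isomorphic to the twisted structure of record `σOfRecord 𝒟 e`, then
`ModelOfRecordCohUnitaryStmt` holds — assembly: ★ 2c `hwLines_of_isCohUnitaryIrrep` feeds `exists_datum`; `HasChiScalars`.2 + ★ `labelE_eq_of_center` give the
central label and (prelims) a nonzero `u n m`; the labels give `6 ∣ m − 3n + 3 + 2e`; ★ `exists_mk_eq_mk_ofRecord` pins the class.
[cite: Kovacevic2021, §3 Thm. 1–3] [cite: BorelWallach2000, 0 §2.5] -/
theorem modelOfRecordCohUnitary_of_lieEquivOfDatum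
    (h5b : ∀ (r : GKIrrep G21) (e : ℤ) (𝒟 : SU21Datum) (u : ℤ → ℤ → r.V),
      (∀ n m : ℤ, u n m ≠ 0 → ∃ w, labelN w = n ∧ labelM w = m ∧ labelE w = e ∧ u n m ∈ hwSpace r.ρ𝔤 w) →
      (∀ n m : ℤ, (n, m) ∈ 𝒟.S ↔ u n m ≠ 0) →
      (∀ (w : Fin 2 ⊕ Fin 1 → ℤ) (y : r.V), labelE w = e → y ∈ hwSpace r.ρ𝔤 w → ∃ c : ℂ, y = c • u (labelN w) (labelM w)) →
      (∀ n m : ℤ, u n m ≠ 0 → (u21f r.ρ𝔤 ^ n.toNat) (u n m) = 0 ∧ ∀ k < n.toNat, (u21f r.ρ𝔤 ^ k) (u n m) ≠ 0) →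
      (∀ (n m : ℤ) (k : ℕ),
        u21E r.ρ𝔤 0 (((-u21f r.ρ𝔤) ^ k) (u n m)) =
            (((n : ℂ) - k) * 𝒟.A n m) • ((-u21f r.ρ𝔤) ^ k) (u (n + 1) (m + 3)) + ((k : ℂ) * 𝒟.C n m) • ((-u21f r.ρ𝔤) ^ (k - 1)) (u (n - 1) (m + 3)) ∧
        u21E r.ρ𝔤 1 (((-u21f r.ρ𝔤) ^ k) (u n m)) =
            (-𝒟.A n m) • ((-u21f r.ρ𝔤) ^ (k + 1)) (u (n + 1) (m + 3)) + 𝒟.C n m • ((-u21f r.ρ𝔤) ^ k) (u (n - 1) (m + 3)) ∧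
        u21F r.ρ𝔤 1 (((-u21f r.ρ𝔤) ^ k) (u n m)) =
            (((n : ℂ) - k) * 𝒟.B n m) • ((-u21f r.ρ𝔤) ^ k) (u (n + 1) (m - 3)) - ((k : ℂ) * 𝒟.D n m) • ((-u21f r.ρ𝔤) ^ (k - 1)) (u (n - 1) (m - 3)) ∧
        u21F r.ρ𝔤 0 (((-u21f r.ρ𝔤) ^ k) (u n m)) =
            𝒟.B n m • ((-u21f r.ρ𝔤) ^ (k + 1)) (u (n + 1) (m - 3)) + 𝒟.D n m • ((-u21f r.ρ𝔤) ^ k) (u (n - 1) (m - 3))) →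
      (∃ n m : ℤ, u n m ≠ 0) →
      ∃ Φ : 𝒟.V ≃ₗ[ℂ] r.V, ∀ (X : G21.lie) (x : 𝒟.V), Φ (σOfRecord 𝒟 e X x) = r.ρ𝔤 X (Φ x)) :
    ModelOfRecordCohUnitaryStmt := by
  intro r κ e hr hχ
  have hV : IsGKModule G21 r.ρK r.ρ𝔤 := r.isGKModule
  haveI : Nontrivial r.V := r.isIrreducible.nontrivial
  -- the central label of every weight is `e`
  have he : ∀ (w : Fin 2 ⊕ Fin 1 → ℤ) (v : r.V), v ∈ wtSpace r.ρ𝔤 w → v ≠ 0 → labelE w = e :=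
    fun w v hv hv0 => labelE_eq_of_center r.ρ𝔤 hv hv0 hχ.2
  -- the datum of `r` (★ 4b on ★ 2c's lines)
  obtain ⟨𝒟, u, hi, hii, hiii, hiv, hv⟩ := exists_datum r.ρ𝔤 hV e (hwLines_of_isCohUnitaryIrrep r hr)
  -- some `u n m ≠ 0`
  obtain ⟨w, g, hg, hg0, hwe⟩ := exists_mem_hwSpace_ne_zero hV e he
  obtain ⟨c, hc⟩ := hiii w g hwe hg
  have hS : ∃ n m : ℤ, u n m ≠ 0 := ⟨labelN w, labelM w, fun h0 => hg0 (by rw [hc, h0, smul_zero])⟩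
  -- integrality of the record at `e`
  have hdiv : ∀ n m : ℤ, (n, m) ∈ 𝒟.S → (6 : ℤ) ∣ m - 3 * n + 3 + 2 * e := by
    intro n m hnm
    obtain ⟨w', hN, hM, hE, -⟩ := hi n m ((hii n m).mp hnm)
    exact six_dvd_of_labels hN hM hE
  -- the `𝔤`-isomorphism (5b) and the class
  obtain ⟨Φ, hΦ⟩ := h5b r e 𝒟 u hi hii hiii hiv hv hS
  exact ⟨𝒟, exists_mk_eq_mk_ofRecord r e 𝒟 hdiv Φ hΦ⟩

/-! ## §2 THE HEAD -/

/-- **8b-αᵤ — EVERY COH-UNITARY IRREDUCIBLE `(𝔲(2,1), K)`-MODULE WITH CENTRAL CHARACTER `e` IS THE TWISTED STRUCTURE OF RECORD OF A KOVAČEVIĆ DATUM, UP TO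
`(𝔤, K)`-EQUIVALENCE** (`U8.ModelOfRecordCohUnitaryStmt`, token for token): §1 with `h5b` discharged by ★ αᵤ-5b§2 `exists_lieEquiv_of_datum` (K2E4-p10 (g3)).
[cite: Kovacevic2021, §3 Thm. 1–3] [cite: Kraljevic1973, Thm. (multiplicity one for SU(n,1))] [cite: KnappVogan1995, §I.4 (1.64)–(1.65), §II.4]
[cite: BorelWallach2000, 0 §2.5] -/
theorem modelOfRecordCohUnitary : ModelOfRecordCohUnitaryStmt :=
  modelOfRecordCohUnitary_of_lieEquivOfDatum fun r _ _ _ hi hS _ hstr hT hne =>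
    exists_lieEquiv_of_datum r.ρ𝔤 r.isGKModule r.isIrreducible hi hS hstr hT hne

end Summit.HodgeConjecture.HodgeConjecture.Cruxes.H413.K2E1bGKCohomologyU21.U8

end
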